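import Summits.QuantumFields.BalabanUV.T4Continuum.Spine.NE9.DirectPairingCauchy
import Literature.MathematicalPhysics.QuantumFieldTheory.Balaban1983to89.T4ContinuumYM4Torus

/-!
# T⁴ programme, spine estimate NE9 — KING'S CURRENCY AT NODE U5 AND AT THE APEX, BY NAME: the tree's per-pair hybrid core is
# organisation-agnostic, n-uniform two-run data give King's matching with remainders that need only TEND TO ZERO, and King's
# per-string socket IS the apex's `StringwiseGenFunCauchy` ⇒ `HasContinuumLimit` ⇒ `ContinuumYM4Torus` — census item C38 of cell
# `pub-balaban-gaps`, seat ne9 (gen 10)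

Cell `pub-balaban-gaps` (YM blitz G2, seat ne9, unit `pub-balaban-gaps-ne9-g10`; record `run/shared/lean/pub/pub-balaban-gaps/ne/NE9.md`
§5 row C38).  Summits-side bookkeeping; elementary real analysis and modus ponens over the tree's node-U5∕U6∕U0∕apex vocabulary
(`T4HybridMatching.HybridSandwich`, `hybridDelta`; `T4CauchySum.genFun`, `MatchingModConstants`; `T4GenFunBounds.schemeZ`;
`T4ApexHybrid.StringwiseGenFunCauchy`, `StringwiseHybridNE7`, `StringwiseUnder`; `Missing.HasContinuumLimit`;
`T4ContinuumYM4Torus.ContinuumYM4Torus`).  NO definition is made (King's shapes are written INLINE as hypotheses); nothing of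
Bałaban's is asserted.

WHY (the question gens 6–9 left in words).  The King-currency line of this seat (census C30–C37f) showed: GIVEN tower-NE5, node U3 → U6
needs from the E-side only QUALITATIVE step clauses (the list of `NE9.md` §17), because King's organisation of node U6 compares the runs
with `K` and `K + n` steps DIRECTLY and charges remainders that merely tend to zero (`DirectPairingCauchy.cauchySeq_genFun_of_unif`),
whereas the cell's consecutive organisation (`T4CauchySum.MatchingModConstants` + `Summable δ`, node U4′) charges ℓ¹ and thereby
forces a QUANTITATIVE modulus on the E-side (C26) — i.e. NE9's Lipschitz∕fading SHAPE.  The record (§6 [v1.9]) left the price of the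
re-organisation in words: *"node U5∕U6's other producers restated for the pair (K, K + n) uniformly in n — not typed, owner T4-DAG"*
and *"the apex consumes only `CauchySeq genFun`"*.  This file types both ends of that sentence against the tree BY NAME:
* §1 `tendsto_hybridDelta`: the hybrid remainder `hybridDelta vol δ W K = δ K + (−log(1 − W K))∕vol` tends to zero as soon as the
  term-wise remainder `δ K → 0` and the bad weight `W K → 0` — NO summability (compare `T4HybridMatching.summable_hybridDelta`).
* §2 `kingMatching_of_hybridSandwich`: the tree's PER-PAIR core `T4HybridMatching.HybridSandwich.abs_log_sum_sub_le` is
  organisation-agnostic — for a family of two-run hybrid data indexed by `(K, n)` (run A = `K` steps, run B = `K + n` steps, its terms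
  partially summed into run A's classes) whose sandwich width `vol·δ K` and bad weight `W K` do NOT depend on `n`, the dressed partition
  functions match modulo `t`-independent constants, `|log Z_{K+n}(t) − log Z_K(t) − c_{K,n}| ≤ vol·hybridDelta vol δ W K`, for every `n`
  — King's (3.9)∕(3.10)–(3.13) shape; `cauchy_of_hybridSandwichFamily`: with `δ → 0`, `W → 0` every generating function is Cauchy and
  converges uniformly on the `l₀`-ball (node U0's input) — `Summable δ` ∕ `Summable W` (node U4′) are NOT used.
* §3 (scheme level) `stringwiseGenFunCauchy_of_king`: King's PER-STRING socket — for every string an `l₀ > 0`, a `vol`, an offset `K₀`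
  and remainders `Δ_K → 0` with `|log Z_{K₀+K+n}(t) − log Z_{K₀+K}(t) − c| ≤ vol·Δ_K` on `|t| ≤ l₀` — IS the apex's
  `T4ApexHybrid.StringwiseGenFunCauchy S` (offset removed by `cauchySeq_shift`), hence `hasContinuumLimit_of_king`
  (`Missing.HasContinuumLimit S`, by `T4ApexHybrid.hasContinuumLimit_of_stringwise`); `stringwiseGenFunCauchy_of_kingHybrid`: the same
  from per-string n-uniform HYBRID data, positivity of the dressed partition functions DISCHARGED (`T4GenFunBounds.dressedZ_pos`).
* §4 (under the targets' prefix, `SU(N)`, printed averaging) `stringwiseUnder_of_kingUnder`, `continuumYM4Torus_of_kingUnder`: King's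
  per-string socket under the prefix ⇒ `T4ApexHybrid.StringwiseUnder` ⇒ `ContinuumYM4Torus D` by the tree's
  `T4ContinuumYM4Torus.continuumYM4_torus_of_BetaPertH_stringwise` — the headline with the spine slot `hNE : HybridNE7Under` REPLACED by
  King's socket, (B) and the β-input untouched.
* §5 `king_of_stringwiseHybridNE7`: the cell's consecutive per-string data (`T4ApexHybrid.StringwiseHybridNE7`, node U5's output as
  typed) IMPLY King's socket (tails of the summable remainders, `DirectPairingCauchy.kingShape_of_matchingModConstants` +
  `T4MatchingAssembly.matchingModConstants_schemeZ`): King's socket sits BETWEEN the cell's node-U5 output and the apex input, so the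
  re-organisation costs nothing at the apex.

VERDICT FOR THE ROW (census C38).  The consecutive currency's `Summable δ` — the one clause that makes a quantitative E-side modulus
(hence NE9's SHAPE) necessary for node U3 → U6 (C26, `MemoryFromRateSharp`) — is NOT consumed by the apex: `ContinuumYM4Torus` is
reached BY NAME from King's per-string socket, and the per-pair hybrid core that produces node U5 is the tree's own lemma, indifferent
to whether run B is `K + 1` or `K + n` steps long.  HONEST RESIDUE (not typed here, stated precisely): the n-UNIFORM two-run hybrid
data for the pair (K, K + n) — the index family `T K n` (run B's terms partially summed into run A's classes over `n` extra scales,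
node U5d's fibre construction iterated), bad weights `W K` serving both runs (NE7b for a run of ≥ K steps), and the good-class sandwich
with width `vol·δ K`, `δ K = Σ_j ρ^{K−j}·inj_j` collecting the one-step sources (n-uniform by geometric summation, tower-NE5 iterated:
`C₅θ^j∕(1 − θ)`), node U2's tails and the E-side direct bracket `b_j → 0` of `DirectPairing.directBracket_eventually_le`
(`DirectPairingCauchy.tendsto_delta_of_profile`) — are NE7∕NE7b∕NE7c-type statements for runs `n` apart, of the SAME shapes as the
tree's consecutive producers (`T4MatchingClosure*`); instance on Bałaban's objects 0∕1.  CLASSIFICATION OF NE9 UNCHANGED: WORK-bound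
(W1).  What changes for the planner: the NE9 slot of the spine can be re-wired END TO END — E-side list of `NE9.md` §17 (no
`FadingMemory`, no modulus, no g-form, no vertex wall W5) → `DirectPairing*` (U3 → U6 in King's currency) → THIS FILE (U5-King →
`StringwiseGenFunCauchy` → `ContinuumYM4Torus`) — with every junction a kernel theorem BY NAME and the only untyped link the n-uniform
restatement of node U5's producers.

HONEST FRAMING: bookkeeping for rung (B)+1 on ONE FIXED finite four-torus; every hypothesis below is a SHAPE (King's matching, hybrid
data, (B) pinned, the β-input), none is asserted for Bałaban's d = 4 procedure; NE7∕NE9∕NE5 NOT PRINTED ∕ NOT PROVED; spine PROVED 0∕9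
unchanged; instance 0∕1; NOT UV stability, NOT the continuum limit, NOT infinite volume, NOT a mass gap, NOT Clay.  HONEST DEPENDENCY:
continuum YM on T⁴ ⇐ BetaPertH ∧ nine spine estimates (0∕9 proved); BetaPertH ⇐ (D1) ∧ (D4) ∧ CAP+tail.

References (TYPES only): [King1986] = C. King, Commun. Math. Phys. **102** (1986) 649–677, Thm 3.4 (3.9) p. 656 (effective actions of
the lattices `T_{ε_K}` and `T_{ε_{K+n}}` compared directly), (3.10)–(3.13) pp. 656–657, p. 657 *"Hence {Z^{ε_K}(T_{ε_K}, g, h)} is a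
Cauchy sequence"*; [JaffeWittenClay2006] §6.5 p. 11 (the apex predicate's source, via the tree).
-/

namespace Summit.QuantumFields.BalabanUV.T4Continuum.NE9.DirectPairingApex

open scoped BigOperators
open Finset Filter Topology
open Literature.MathematicalPhysics.QuantumFieldTheory.Balaban1983to89
open T4CauchySum (genFun genFunLim MatchingModConstants)
open T4HybridMatching (HybridSandwich hybridDelta mul_hybridDelta)
open Missing (TorusScheme HasContinuumLimit)
open T4Continuum
open Summit.QuantumFields.BalabanUV.T4Continuum.NE9.DirectPairingCauchy
  (cauchySeq_genFun_of_unif tendstoUniformlyOn_genFun_of_unif kingShape_of_matchingModConstants)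

/-! ## §1 The hybrid remainders tend to zero without any summability -/

/-- `W_K → 0` ⇒ `−log(1 − W_K) → 0` (continuity of `log` at `1`). [folklore] -/
theorem tendsto_neg_log_one_sub {W : ℕ → ℝ} (hW : Tendsto W atTop (𝓝 0)) :
    Tendsto (fun K => -Real.log (1 - W K)) atTop (𝓝 0) := by
  have h1 : Tendsto (fun K => 1 - W K) atTop (𝓝 1) := by simpa using hW.const_sub 1
  have h2 : Tendsto (fun K => Real.log (1 - W K)) atTop (𝓝 (Real.log 1)) := h1.log one_ne_zero
  rw [Real.log_one] at h2
  simpa using h2.neg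

/-- **THE HYBRID REMAINDERS TEND TO ZERO** as soon as the term-wise remainders `δ K → 0` and the bad weights `W K → 0`:
`hybridDelta vol δ W K = δ K + (−log(1 − W K))∕vol → 0`.  King's organisation of node U6 asks no more (compare the consecutive
organisation's `T4HybridMatching.summable_hybridDelta`: `Summable δ`, `Summable W`). [folklore] -/
theorem tendsto_hybridDelta {vol : ℝ} {δ W : ℕ → ℝ} (hδ : Tendsto δ atTop (𝓝 0)) (hW : Tendsto W atTop (𝓝 0)) :
    Tendsto (hybridDelta vol δ W) atTop (𝓝 0) := by
  have h : Tendsto (fun K => δ K + -Real.log (1 - W K) / vol) atTop (𝓝 (0 + 0 / vol)) :=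
    hδ.add ((tendsto_neg_log_one_sub hW).div_const vol)
  rw [zero_div, add_zero] at h
  exact h

/-! ## §2 The per-pair hybrid core in King's organisation: runs `K` and `K + n`, n-uniform data -/

section Pair

variable {ι : Type*} [DecidableEq ι] {vol l₀ : ℝ} {δ W : ℕ → ℝ} {Z : ℕ → ℝ → ℝ}

/-- **KING'S MATCHING MODULO CONSTANTS FROM n-UNIFORM TWO-RUN HYBRID DATA.**  For every pair `(K, n)` let run A (`K` steps) have
dressed partition function `Z K t = Σ_{τ ∈ T K n} A K n t τ` with positive total and run B (`K + n` steps) `Z (K + n) t =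
Σ_{τ ∈ T K n} B K n t τ` on `|t| ≤ l₀`, and let the two families satisfy the tree's `HybridSandwich` on some good set with a
`t`-independent constant, sandwich width `vol·δ K` and relative bad weight `W K < 1` — BOTH INDEPENDENT OF `n`.  Then
`|log Z_{K+n}(t) − log Z_K(t) − c_{K,n}| ≤ vol·hybridDelta vol δ W K` for all `K`, `n`: the per-pair core
`HybridSandwich.abs_log_sum_sub_le` BY NAME — it never knew that run B was the next run. [cite: King1986, Thm 3.4 (3.9) p. 656]
[folklore] -/
theorem kingMatching_of_hybridSandwich (hvol : 0 < vol) (T : ℕ → ℕ → Finset ι) (A B : ℕ → ℕ → ℝ → ι → ℝ)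
    (hZA : ∀ K n t, |t| ≤ l₀ → Z K t = ∑ τ ∈ T K n, A K n t τ)
    (hZB : ∀ K n t, |t| ≤ l₀ → Z (K + n) t = ∑ τ ∈ T K n, B K n t τ)
    (hW : ∀ K, W K < 1) (hpos : ∀ K n t, |t| ≤ l₀ → 0 < ∑ τ ∈ T K n, A K n t τ)
    (h : ∀ K n : ℕ, ∃ c : ℝ, ∀ t : ℝ, |t| ≤ l₀ →
      ∃ Gd : Finset ι, HybridSandwich (T K n) Gd (A K n t) (B K n t) c (vol * δ K) (W K)) :
    ∀ K n : ℕ, ∃ c : ℝ, ∀ t : ℝ, |t| ≤ l₀ →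
      |Real.log (Z (K + n) t) - Real.log (Z K t) - c| ≤ vol * hybridDelta vol δ W K := by
  intro K n
  obtain ⟨c, hc⟩ := h K n
  refine ⟨c, fun t ht => ?_⟩
  obtain ⟨Gd, hG⟩ := hc t ht
  rw [hZA K n t ht, hZB K n t ht, mul_hybridDelta hvol.ne']
  exact hG.abs_log_sum_sub_le (hW K) (hpos K n t ht)

/-- **NODE U6 IN KING'S ORGANISATION FROM n-UNIFORM HYBRID DATA — NO SUMMABILITY.**  Under the hypotheses of
`kingMatching_of_hybridSandwich`, `0 ≤ l₀`, `δ K → 0` and `W K → 0`: every generating function `K ↦ genFun Z K t`, `|t| ≤ l₀`, is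
Cauchy and the convergence to `genFunLim Z` is uniform on the closed `l₀`-ball (node U0's input).  Compare
`T4HybridMatching.cauchy_of_hybrid` (consecutive runs, `Summable δ`, `Summable W`). [cite: King1986, p. 657] [folklore] -/
theorem cauchy_of_hybridSandwichFamily (hvol : 0 < vol) (hl₀ : 0 ≤ l₀) (T : ℕ → ℕ → Finset ι)
    (A B : ℕ → ℕ → ℝ → ι → ℝ)
    (hZA : ∀ K n t, |t| ≤ l₀ → Z K t = ∑ τ ∈ T K n, A K n t τ)
    (hZB : ∀ K n t, |t| ≤ l₀ → Z (K + n) t = ∑ τ ∈ T K n, B K n t τ)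
    (hW : ∀ K, W K < 1) (hδ : Tendsto δ atTop (𝓝 0)) (hW0 : Tendsto W atTop (𝓝 0))
    (hpos : ∀ K n t, |t| ≤ l₀ → 0 < ∑ τ ∈ T K n, A K n t τ)
    (h : ∀ K n : ℕ, ∃ c : ℝ, ∀ t : ℝ, |t| ≤ l₀ →
      ∃ Gd : Finset ι, HybridSandwich (T K n) Gd (A K n t) (B K n t) c (vol * δ K) (W K)) :
    (∀ t : ℝ, |t| ≤ l₀ → CauchySeq fun K => genFun Z K t) ∧
      TendstoUniformlyOn (fun K t => genFun Z K t) (genFunLim Z) atTop {t | |t| ≤ l₀} := by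
  have hK := kingMatching_of_hybridSandwich hvol T A B hZA hZB hW hpos h
  have hΔ : Tendsto (hybridDelta vol δ W) atTop (𝓝 0) := tendsto_hybridDelta hδ hW0
  exact ⟨fun t ht => cauchySeq_genFun_of_unif hK hl₀ hΔ ht, tendstoUniformlyOn_genFun_of_unif hK hl₀ hΔ⟩

end Pair

/-! ## §3 Scheme level: King's per-string socket IS the apex's `StringwiseGenFunCauchy` -/

section Scheme

variable {G : Type*} [GaugeGroup G] [MeasurableSpace G] [RegularGaugeGroup G] [HaarData G] {O : Type*}

omit [RegularGaugeGroup G] in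
/-- **KING'S PER-STRING SOCKET ⇒ `StringwiseGenFunCauchy`.**  If every string `os` carries a radius `l₀ > 0`, a volume factor `vol`,
an offset `K₀` and remainders `Δ_K → 0` such that for all `K`, `n` some `t`-independent constant `c` gives
`|log Z_{K₀+K+n}(t) − log Z_{K₀+K}(t) − c| ≤ vol·Δ_K` on `|t| ≤ l₀` (`Z = schemeZ S os`, the string's dressed partition functions),
then `K ↦ genFun (schemeZ S os) K t` is Cauchy for `|t| ≤ l₀`, every string — LITERALLY node U6's per-string output
`T4ApexHybrid.StringwiseGenFunCauchy S` that the apex consumes.  No `Summable`, no positivity, no `β ≥ 0` is needed at this junction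
(the offset is removed by `cauchySeq_shift`). [cite: King1986, p. 657] [folklore] -/
theorem stringwiseGenFunCauchy_of_king (S : TorusScheme G O)
    (hK : ∀ os : List O, ∃ (l₀ vol : ℝ) (K₀ : ℕ) (Δ : ℕ → ℝ), 0 < l₀ ∧ Tendsto Δ atTop (𝓝 0) ∧
      ∀ K n : ℕ, ∃ c : ℝ, ∀ t : ℝ, |t| ≤ l₀ →
        |Real.log (T4GenFunBounds.schemeZ S os (K₀ + (K + n)) t) -
            Real.log (T4GenFunBounds.schemeZ S os (K₀ + K) t) - c| ≤ vol * Δ K) :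
    T4ApexHybrid.StringwiseGenFunCauchy S := fun os => by
  obtain ⟨l₀, vol, K₀, Δ, hl₀, hΔ, hU5⟩ := hK os
  refine ⟨l₀, hl₀, fun t ht => ?_⟩
  have hc : CauchySeq fun K => genFun (fun K => T4GenFunBounds.schemeZ S os (K₀ + K)) K t :=
    cauchySeq_genFun_of_unif (Z := fun K => T4GenFunBounds.schemeZ S os (K₀ + K)) hU5 hl₀.le hΔ ht
  have e : (fun n => genFun (T4GenFunBounds.schemeZ S os) (n + K₀) t) =
      fun K => genFun (fun K => T4GenFunBounds.schemeZ S os (K₀ + K)) K t := by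
    funext n
    simp only [genFun, add_comm]
  exact (cauchySeq_shift K₀).1 (e ▸ hc)

/-- **… ⇒ THE CONTINUUM LIMIT OF EVERY JOINT EXPECTATION EXISTS along the full sequence of spacings** (`Missing.HasContinuumLimit S`),
for a scheme with `β_K ≥ 0` and measurable observables bounded by `1` — the tree's per-string node U0
`T4ApexHybrid.hasContinuumLimit_of_stringwise` BY NAME. [folklore] -/
theorem hasContinuumLimit_of_king (S : TorusScheme G O) (hβ : ∀ K, 0 ≤ S.β K)
    (hm : ∀ K o, Measurable (S.obs K o)) (h1 : ∀ K o U, |S.obs K o U| ≤ 1)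
    (hK : ∀ os : List O, ∃ (l₀ vol : ℝ) (K₀ : ℕ) (Δ : ℕ → ℝ), 0 < l₀ ∧ Tendsto Δ atTop (𝓝 0) ∧
      ∀ K n : ℕ, ∃ c : ℝ, ∀ t : ℝ, |t| ≤ l₀ →
        |Real.log (T4GenFunBounds.schemeZ S os (K₀ + (K + n)) t) -
            Real.log (T4GenFunBounds.schemeZ S os (K₀ + K) t) - c| ≤ vol * Δ K) :
    HasContinuumLimit S :=
  T4ApexHybrid.hasContinuumLimit_of_stringwise S hβ hm h1 (stringwiseGenFunCauchy_of_king S hK)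

/-- **FROM PER-STRING n-UNIFORM HYBRID DATA** (King's organisation of node U5, §2) **TO `StringwiseGenFunCauchy`**, with the
positivity of the dressed partition functions DISCHARGED (`T4GenFunBounds.dressedZ_pos`) for a scheme with `β_K ≥ 0` and measurable
observables bounded by `1`: per string, from some offset `K₀` on, an index type, families `T K n`, `A K n`, `B K n`, remainders
`δ K → 0`, bad weights `W K → 0`, `W K < 1`, the dictionary with `schemeZ S os (K₀ + K)` ∕ `schemeZ S os (K₀ + K + n)`, and the
n-uniform good-class sandwich.  Compare `T4MatchingAssembly.matchingModConstants_schemeZ` ∕ `T4ApexHybrid.stringwise_of_stringwiseHybridNE7`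
(consecutive runs, summable remainders). [folklore] -/
theorem stringwiseGenFunCauchy_of_kingHybrid (S : TorusScheme G O) (hβ : ∀ K, 0 ≤ S.β K)
    (hm : ∀ K o, Measurable (S.obs K o)) (h1 : ∀ K o U, |S.obs K o U| ≤ 1)
    (hK : ∀ os : List O, ∃ (l₀ vol : ℝ) (K₀ : ℕ), 0 < l₀ ∧ 0 < vol ∧
      ∃ (ι : Type) (_ : DecidableEq ι) (T : ℕ → ℕ → Finset ι) (A B : ℕ → ℕ → ℝ → ι → ℝ) (δ W : ℕ → ℝ),
        Tendsto δ atTop (𝓝 0) ∧ Tendsto W atTop (𝓝 0) ∧ (∀ K, W K < 1) ∧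
        (∀ K n t, |t| ≤ l₀ → T4GenFunBounds.schemeZ S os (K₀ + K) t = ∑ τ ∈ T K n, A K n t τ) ∧
        (∀ K n t, |t| ≤ l₀ → T4GenFunBounds.schemeZ S os (K₀ + (K + n)) t = ∑ τ ∈ T K n, B K n t τ) ∧
        ∀ K n : ℕ, ∃ c : ℝ, ∀ t : ℝ, |t| ≤ l₀ →
          ∃ Gd : Finset ι, HybridSandwich (T K n) Gd (A K n t) (B K n t) c (vol * δ K) (W K)) :
    T4ApexHybrid.StringwiseGenFunCauchy S := by
  refine stringwiseGenFunCauchy_of_king S fun os => ?_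
  obtain ⟨l₀, vol, K₀, hl₀, hvol, ι, _, T, A, B, δ, W, hδ, hW0, hW, hZA, hZB, h⟩ := hK os
  have hpos : ∀ K n t, |t| ≤ l₀ → 0 < ∑ τ ∈ T K n, A K n t τ := fun K n t ht => by
    rw [← hZA K n t ht]
    unfold T4GenFunBounds.schemeZ
    exact T4GenFunBounds.dressedZ_pos (S.P (K₀ + K)) (hβ (K₀ + K))
      (T4GenFunBounds.measurable_prodObs S hm (K₀ + K) os) (T4GenFunBounds.abs_prodObs_le_one S h1 (K₀ + K) os) t
  exact ⟨l₀, vol, K₀, hybridDelta vol δ W, hl₀, tendsto_hybridDelta hδ hW0,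
    kingMatching_of_hybridSandwich (Z := fun K => T4GenFunBounds.schemeZ S os (K₀ + K)) hvol T A B hZA hZB hW hpos h⟩

/-! ## §5 (placed here for the section variables) The cell's consecutive per-string data IMPLY King's socket -/

/-- **CONSECUTIVE ⇒ KING, PER STRING.**  Node U5's per-string output AS TYPED (`T4ApexHybrid.StringwiseHybridNE7 S`: hybrid-NE7 data
for consecutive runs with SUMMABLE remainders) implies King's per-string socket, with offset `0`, the same radius and volume factor,
and the TAILS `Δ_K = Σ_m δ′_{m+K} → 0` of the summable consecutive remainders as King's remainders
(`T4MatchingAssembly.matchingModConstants_schemeZ` + `DirectPairingCauchy.kingShape_of_matchingModConstants` BY NAME; `δ′ ≥ 0` is read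
off the matching at `t = 0`).  So King's socket is NOT stronger than the cell's: it sits between node U5's output and the apex's
input. [folklore] -/
theorem king_of_stringwiseHybridNE7 (S : TorusScheme G O) (hβ : ∀ K, 0 ≤ S.β K)
    (hm : ∀ K o, Measurable (S.obs K o)) (h1 : ∀ K o U, |S.obs K o U| ≤ 1) (h : T4ApexHybrid.StringwiseHybridNE7 S) :
    ∀ os : List O, ∃ (l₀ vol : ℝ) (K₀ : ℕ) (Δ : ℕ → ℝ), 0 < l₀ ∧ Tendsto Δ atTop (𝓝 0) ∧
      ∀ K n : ℕ, ∃ c : ℝ, ∀ t : ℝ, |t| ≤ l₀ →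
        |Real.log (T4GenFunBounds.schemeZ S os (K₀ + (K + n)) t) -
            Real.log (T4GenFunBounds.schemeZ S os (K₀ + K) t) - c| ≤ vol * Δ K := by
  intro os
  obtain ⟨l₀, vol, K₀, hl₀, hvol, hH⟩ := h os
  obtain ⟨δ', hδ's, hM⟩ := T4MatchingAssembly.matchingModConstants_schemeZ S hβ hm h1 hl₀.le hvol os hH
  have hδ'0 : ∀ K, 0 ≤ δ' K := fun K => by
    obtain ⟨c, hc⟩ := hM K
    have h0 := hc 0 (by rw [abs_zero]; exact hl₀.le)
    have hv : 0 ≤ vol * δ' K := (abs_nonneg _).trans h0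
    exact (mul_nonneg_iff_of_pos_left hvol).mp hv
  refine ⟨l₀, vol, 0, fun K => ∑' m, δ' (m + K), hl₀, tendsto_sum_nat_add δ', fun K n => ?_⟩
  obtain ⟨c, hc⟩ := kingShape_of_matchingModConstants hM hvol.le hδ'0 hδ's K n
  exact ⟨c, fun t ht => by simpa only [zero_add] using hc t ht⟩

end Scheme

/-! ## §4 Under the targets' quantifier prefix: King's socket feeds `ContinuumYM4Torus` by name -/

section Prefix

variable {F : T4Family} {G : Type*} [GaugeGroup G] [MeasurableSpace G] [RegularGaugeGroup G] [HaarData G]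

omit [RegularGaugeGroup G] in
/-- **KING'S SOCKET UNDER THE PREFIX ⇒ `StringwiseUnder`** (any β-side hypothesis `Hβ`), along the data's Wilson schemes. [folklore] -/
theorem stringwiseUnder_of_kingUnder (D : FiniteEpsData F G) {Hβ : Prop}
    (hK : D.UnderHypotheses Hβ fun g₀ =>
      ∀ os : List (ULoop F), ∃ (l₀ vol : ℝ) (K₀ : ℕ) (Δ : ℕ → ℝ), 0 < l₀ ∧ Tendsto Δ atTop (𝓝 0) ∧
        ∀ K n : ℕ, ∃ c : ℝ, ∀ t : ℝ, |t| ≤ l₀ →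
          |Real.log (T4GenFunBounds.schemeZ (D.scheme g₀) os (K₀ + (K + n)) t) -
              Real.log (T4GenFunBounds.schemeZ (D.scheme g₀) os (K₀ + K) t) - c| ≤ vol * Δ K) :
    T4ApexHybrid.StringwiseUnder D Hβ :=
  FiniteEpsData.UnderHypotheses.mono (fun g₀ hg => stringwiseGenFunCauchy_of_king (D.scheme g₀) hg) hK

end Prefix

section Headline

variable {F : T4Family} {N : ℕ} [NeZero N]

/-- **THE HEADLINE WITH THE SPINE SLOT IN KING'S CURRENCY.**  For a finite-`ε` datum `D` on `SU(N)` averaged by one of Bałaban's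
printed prescriptions, ASSUME as named binders: (B) pinned (`B16.EndStatementBPrinted D.C`), the scoping note's β-input
(`BetaPertHyp D.βfun`), and — IN PLACE OF the hybrid-NE7 slot `hNE : HybridNE7Under D _` of
`T4ContinuumYM4Torus.continuumYM4_torus_of_BetaPertH` — KING'S PER-STRING SOCKET under the same prefix: per string, matching of the
dressed partition functions of the runs `K₀ + K` and `K₀ + K + n` modulo `t`-independent constants with remainders `vol·Δ_K`,
`Δ_K → 0`, uniformly in `n`.  THEN `ContinuumYM4Torus D` (existence and uniqueness of the `ε → 0` limit of the joint expectations of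
the unit-scale averaged loop variables, reflection positivity and covariance of the limit points), by the tree's
`continuumYM4_torus_of_BetaPertH_stringwise` BY NAME.  Nothing is summed over the cutoffs anywhere on this path.  ONE torus; every
binder a hypothesis; NOT a mass gap; NOT Clay. [cite: King1986, Thm 3.4 (3.9) p. 656] [folklore] -/
theorem continuumYM4Torus_of_kingUnder (D : FiniteEpsData F (Matrix.specialUnitaryGroup (Fin N) ℂ))
    (hD : D.IsPrintedAveraged) (hB : B16.EndStatementBPrinted D.C) (hβ : BetaPertHyp D.βfun)
    (hK : D.UnderHypotheses (BetaPertHyp D.βfun) fun g₀ =>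
      ∀ os : List (ULoop F), ∃ (l₀ vol : ℝ) (K₀ : ℕ) (Δ : ℕ → ℝ), 0 < l₀ ∧ Tendsto Δ atTop (𝓝 0) ∧
        ∀ K n : ℕ, ∃ c : ℝ, ∀ t : ℝ, |t| ≤ l₀ →
          |Real.log (T4GenFunBounds.schemeZ (D.scheme g₀) os (K₀ + (K + n)) t) -
              Real.log (T4GenFunBounds.schemeZ (D.scheme g₀) os (K₀ + K) t) - c| ≤ vol * Δ K) :
    T4ContinuumYM4Torus.ContinuumYM4Torus D :=
  T4ContinuumYM4Torus.continuumYM4_torus_of_BetaPertH_stringwise D hD hB hβ (stringwiseUnder_of_kingUnder D hK)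

/-- **… AND THE CELL'S HEADLINE FACTORS THROUGH IT**: the hybrid-NE7 slot `HybridNE7Under D (BetaPertHyp D.βfun)` implies King's socket
under the prefix (`king_of_stringwiseHybridNE7` scheme by scheme; `β_K ≥ 0`, measurability and `|obs| ≤ 1` are the data's own
bookkeeping facts), so `continuumYM4Torus_of_kingUnder` RECOVERS `T4ContinuumYM4Torus.continuumYM4_torus_of_betaPertHyp`. [folklore] -/
theorem continuumYM4Torus_of_hybridNE7Under_via_king (D : FiniteEpsData F (Matrix.specialUnitaryGroup (Fin N) ℂ))
    (hD : D.IsPrintedAveraged) (hB : B16.EndStatementBPrinted D.C) (hβ : BetaPertHyp D.βfun)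
    (hNE : T4ApexHybrid.HybridNE7Under D (BetaPertHyp D.βfun)) : T4ContinuumYM4Torus.ContinuumYM4Torus D :=
  continuumYM4Torus_of_kingUnder D hD hB hβ
    (FiniteEpsData.UnderHypotheses.mono (fun g₀ hg =>
      king_of_stringwiseHybridNE7 (D.scheme g₀) (fun K => (D.scheme_β_eq g₀ K).2)
        (fun K C => D.measurable_avgObs hD.avgMeasurable K C) (fun K C U => D.abs_avgObs_le_one K C U) hg) hNE)

end Headline

end Summit.QuantumFields.BalabanUV.T4Continuum.NE9.DirectPairingApex
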